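import Mathlib.Analysis.SpecialFunctions.Gaussian.FourierTransform
import Mathlib.Analysis.SpecialFunctions.Gamma.Basic
import Mathlib.MeasureTheory.Integral.Prod
import HarnessLib

/-!
# The Fourier transform of the power kernels (‖x‖² + t²)^{-s}: Schwinger parametrisation

Topic `Literature/Analysis/Fourier`. Everything in this file is PROVED (no named facts).

Let `V` be a finite-dimensional real inner product space of dimension `d`, let `t > 0` and
`s > d / 2` (the range in which the power kernel `v ↦ (‖v‖² + t²)^{-s}` is integrable on `V`).
Its Fourier transform in Mathlib's convention `𝓕 f (w) = ∫ exp(-2πi⟪v, w⟫) f(v) dv` is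
`𝓕[(‖·‖² + t²)^{-s}](w) = π^{d/2} / Γ(s) · ∫₀^∞ μ^{s-1-d/2} exp(-π²‖w‖²/μ - μ t²) dμ`
(`fourierIntegral_normSq_add_sq_rpow_neg`). Classically the right-hand side is evaluated through
the Macdonald function, `𝓕[(‖x‖² + t²)^{-s}](w) = (2 π^s / Γ(s)) (‖w‖ / t)^{s - d/2}
K_{s - d/2}(2 π t ‖w‖)`, and the case `s = (d + 1)/2` is the Poisson kernel; we prove the
Bessel-free integral form, which is what the layer-by-layer (in-plane Fourier mode) analysis of
lattice sums of Lennard-Jones type kernels `r^{-2s}` uses: a subsequent substitution turns the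
`μ`-integral into a Laplace transform in `t` supported on `[2π‖w‖, ∞)`.

## Proof

Schwinger (Gamma-function) parametrisation: for `c > 0`,
`c^{-s} = Γ(s)⁻¹ ∫₀^∞ μ^{s-1} e^{-μ c} dμ` (`rpow_neg_eq_inv_Gamma_mul_integral`, from Mathlib's
`Real.integral_rpow_mul_exp_neg_mul_Ioi`). With `c = ‖v‖² + t²` the Fourier integrand becomes
`∫₀^∞ 𝐞(-⟪v, w⟫) Γ(s)⁻¹ μ^{s-1} e^{-μ t²} e^{-μ ‖v‖²} dμ`; the absolute integrand has
`∫_V e^{-μ‖v‖²} dv = (π/μ)^{d/2}` (Mathlib's `GaussianFourier.integral_rexp_neg_mul_sq_norm`)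
and `μ ↦ μ^{s-1-d/2} e^{-μ t²}` is integrable on `(0, ∞)` exactly when `s > d/2`, so Fubini
applies (`MeasureTheory.integrable_prod_iff'`, `MeasureTheory.integral_integral_swap`). The inner
`v`-integral is the Fourier transform of a Gaussian,
`𝓕[e^{-μ‖·‖²}](w) = (π/μ)^{d/2} e^{-π²‖w‖²/μ}` (Mathlib's `fourier_gaussian_innerProductSpace`),
and collecting powers of `μ` gives the claim.

## References

* E. M. Stein, G. Weiss, *Introduction to Fourier Analysis on Euclidean Spaces*, Princeton
  University Press 1971, Ch. I §1 (the Gauss–Weierstrass and Poisson kernels; the Poisson kernel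
  is obtained there by the same subordination to the Gaussian) and Ch. IV (Bessel functions and
  Fourier transforms of radial functions).
* E. M. Stein, *Singular Integrals and Differentiability Properties of Functions*, Princeton
  University Press 1970, Ch. V §3.1 (the Bessel potential kernel `G_α` written as a Gamma-function
  average of Gauss kernels — the present identity for `t² = 1/(4π²)` up to normalisation).
* L. Grafakos, *Classical Fourier Analysis*, Springer GTM 249, §2.2 (the Fourier transform of a
  Gaussian) and Appendix B (Bessel functions); *Modern Fourier Analysis*, GTM 250, §1.2.2
  (Bessel potentials, same subordination identity).
* Classical formula: `𝓕[(|x|² + t²)^{-s}](w) = (2π^s/Γ(s)) (|w|/t)^{s-d/2} K_{s-d/2}(2πt|w|)`.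

What is NOT here: the evaluation of the `μ`-integral as a Macdonald function `K_ν`, the limiting
Riesz-potential case `t = 0`, and the range `s ≤ d/2` (where the kernel is not integrable and the
transform is a distribution).
-/

noncomputable section

namespace Literature.Analysis.Fourier

open _root_.MeasureTheory Set Filter
open scoped FourierTransform Real Topology RealInnerProductSpace

variable {V : Type*} [NormedAddCommGroup V] [InnerProductSpace ℝ V] [FiniteDimensional ℝ V]
  [MeasurableSpace V] [BorelSpace V]

/-- **Schwinger parametrisation.** For `c > 0` and `s > 0`,
`c^{-s} = Γ(s)⁻¹ ∫₀^∞ μ^{s-1} e^{-c μ} dμ`. [folklore] -/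
theorem rpow_neg_eq_inv_Gamma_mul_integral {c s : ℝ} (hc : 0 < c) (hs : 0 < s) :
    c ^ (-s) = (Real.Gamma s)⁻¹ * ∫ μ in Ioi (0 : ℝ), μ ^ (s - 1) * Real.exp (-(c * μ)) := by
  rw [Real.integral_rpow_mul_exp_neg_mul_Ioi hs hc, one_div, Real.inv_rpow hc.le,
    Real.rpow_neg hc.le]
  have hΓ : Real.Gamma s ≠ 0 := (Real.Gamma_pos_of_pos hs).ne'
  field_simp

/-- The Fourier integral of a real multiple of the Gaussian `e^{-μ‖v‖²}`, `μ > 0`, in real form: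
`∫ 𝐞(-⟪v, w⟫) a e^{-μ‖v‖²} dv = a (π/μ)^{d/2} e^{-π²‖w‖²/μ}`. [folklore] -/
theorem integral_fourierChar_smul_const_mul_gaussian {μ : ℝ} (hμ : 0 < μ) (a : ℝ) (w : V) :
    ∫ v : V, 𝐞 (-⟪v, w⟫) • (((a : ℝ) : ℂ) * Complex.exp (-(μ : ℂ) * ‖v‖ ^ 2)) =
      ((a * ((π / μ) ^ ((Module.finrank ℝ V : ℝ) / 2) *
        Real.exp (-π ^ 2 * ‖w‖ ^ 2 / μ)) : ℝ) : ℂ) := by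
  have hμre : 0 < ((μ : ℝ) : ℂ).re := by simpa using hμ
  have hgauss : ∫ v : V, 𝐞 (-⟪v, w⟫) • Complex.exp (-(μ : ℂ) * ‖v‖ ^ 2) =
      (π / (μ : ℂ)) ^ ((Module.finrank ℝ V : ℂ) / 2) * Complex.exp (-π ^ 2 * ‖w‖ ^ 2 / μ) :=
    fourier_gaussian_innerProductSpace hμre w
  have h1 : (∫ v : V, 𝐞 (-⟪v, w⟫) • (((a : ℝ) : ℂ) * Complex.exp (-(μ : ℂ) * ‖v‖ ^ 2))) =
      (a : ℂ) * ∫ v : V, 𝐞 (-⟪v, w⟫) • Complex.exp (-(μ : ℂ) * ‖v‖ ^ 2) := by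
    rw [← integral_const_mul]
    congr 1 with v
    simp only [Circle.smul_def, smul_eq_mul]
    ring
  have e1 : ((π : ℂ) / (μ : ℂ)) ^ ((Module.finrank ℝ V : ℂ) / 2) =
      (((π / μ) ^ ((Module.finrank ℝ V : ℝ) / 2) : ℝ) : ℂ) := by
    rw [Complex.ofReal_cpow (div_pos Real.pi_pos hμ).le]
    push_cast
    ring_nf
  rw [h1, hgauss, e1]
  push_cast
  ring

/-- The `L¹` norm of `v ↦ 𝐞(-⟪v, w⟫) a e^{-μ‖v‖²}`, `μ > 0`: `|a| (π/μ)^{d/2}`. [folklore] -/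
theorem integral_norm_fourierChar_smul_const_mul_gaussian {μ : ℝ} (hμ : 0 < μ) (a : ℝ) (w : V) :
    ∫ v : V, ‖𝐞 (-⟪v, w⟫) • (((a : ℝ) : ℂ) * Complex.exp (-(μ : ℂ) * ‖v‖ ^ 2))‖ =
      |a| * (π / μ) ^ ((Module.finrank ℝ V : ℝ) / 2) := by
  have hnorm : ∀ v : V, ‖𝐞 (-⟪v, w⟫) • (((a : ℝ) : ℂ) * Complex.exp (-(μ : ℂ) * ‖v‖ ^ 2))‖ =
      |a| * Real.exp (-μ * ‖v‖ ^ 2) := by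
    intro v
    have e : -(μ : ℂ) * (‖v‖ : ℂ) ^ 2 = ((-μ * ‖v‖ ^ 2 : ℝ) : ℂ) := by push_cast; ring
    rw [Circle.norm_smul, norm_mul, Complex.norm_real, Real.norm_eq_abs, e, Complex.norm_exp,
      Complex.ofReal_re]
  simp_rw [hnorm]
  rw [integral_const_mul, GaussianFourier.integral_rexp_neg_mul_sq_norm hμ]

/-- Integrability of `v ↦ 𝐞(-⟪v, w⟫) a e^{-μ‖v‖²}` on `V` for `μ > 0`. [folklore] -/
theorem integrable_fourierChar_smul_const_mul_gaussian {μ : ℝ} (hμ : 0 < μ) (a : ℝ) (w : V) :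
    Integrable fun v : V => 𝐞 (-⟪v, w⟫) • (((a : ℝ) : ℂ) * Complex.exp (-(μ : ℂ) * ‖v‖ ^ 2)) := by
  have hμre : 0 < ((μ : ℝ) : ℂ).re := by simpa using hμ
  have hg : Integrable (fun v : V => Complex.exp (-(μ : ℂ) * ‖v‖ ^ 2)) := by
    simpa using GaussianFourier.integrable_cexp_neg_mul_sq_norm_add hμre 0 (0 : V)
  exact (Real.fourierIntegral_convergent_iff w).2 (hg.const_mul _)

omit [FiniteDimensional ℝ V] in
/-- Joint measurability on `V × ℝ` of the Schwinger-parametrised Fourier integrand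
`(v, μ) ↦ 𝐞(-⟪v, w⟫) Γ(s)⁻¹ μ^{s-1} e^{-μt²} e^{-μ‖v‖²}`. [folklore] -/
theorem measurable_fourierChar_smul_schwinger_integrand (s t : ℝ) (w : V) :
    Measurable fun p : V × ℝ =>
      𝐞 (-⟪p.1, w⟫) • (((((Real.Gamma s)⁻¹ * (p.2 ^ (s - 1) * Real.exp (-(p.2 * t ^ 2)))) : ℝ) :
        ℂ) * Complex.exp (-(p.2 : ℂ) * ‖p.1‖ ^ 2)) := by
  have h1 : Continuous fun p : V × ℝ =>
      Complex.exp (((2 * π * -⟪p.1, w⟫ : ℝ) : ℂ) * Complex.I) := by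
    fun_prop
  have h2 : Measurable fun p : V × ℝ =>
      ((Real.Gamma s)⁻¹ * (p.2 ^ (s - 1) * Real.exp (-(p.2 * t ^ 2))) : ℝ) := by
    fun_prop
  have h3 : Continuous fun p : V × ℝ => Complex.exp (-(p.2 : ℂ) * ‖p.1‖ ^ 2) := by
    fun_prop
  exact h1.measurable.mul ((Complex.measurable_ofReal.comp h2).mul h3.measurable)

/-- Integrability on `(0, ∞)` of the `μ`-marginal of the absolute Schwinger integrand,
`μ ↦ |Γ(s)⁻¹ μ^{s-1} e^{-μt²}| (π/μ)^{n/2}`, when `s > n/2` and `t > 0`. [folklore] -/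
theorem integrableOn_schwinger_weight {s t : ℝ} {n : ℕ} (hs : (n : ℝ) / 2 < s) (ht : 0 < t) :
    IntegrableOn (fun μ : ℝ =>
      |(Real.Gamma s)⁻¹ * (μ ^ (s - 1) * Real.exp (-(μ * t ^ 2)))| *
        (π / μ) ^ ((n : ℝ) / 2)) (Ioi 0) := by
  have hn : (0 : ℝ) ≤ (n : ℝ) / 2 := by positivity
  have hs0 : 0 < s := hn.trans_lt hs
  have hb := integrableOn_rpow_mul_exp_neg_mul_rpow (s := s - 1 - (n : ℝ) / 2) (p := 1)
    (b := t ^ 2) (by linarith) le_rfl (by positivity)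
  refine IntegrableOn.congr_fun (hb.const_mul ((Real.Gamma s)⁻¹ * π ^ ((n : ℝ) / 2)))
    (fun μ hμ => ?_) measurableSet_Ioi
  have hμ : (0 : ℝ) < μ := hμ
  have hpos : (0 : ℝ) ≤ (Real.Gamma s)⁻¹ * (μ ^ (s - 1) * Real.exp (-(μ * t ^ 2))) := by
    positivity
  rw [Real.rpow_one, abs_of_nonneg hpos, Real.div_rpow Real.pi_pos.le hμ.le,
    Real.rpow_sub hμ (s - 1) ((n : ℝ) / 2), show -t ^ 2 * μ = -(μ * t ^ 2) by ring]
  ring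

/-- **Fourier transform of the power kernel `(‖v‖² + t²)^{-s}` (Schwinger form).** For a
finite-dimensional real inner product space `V` of dimension `d`, `s > d/2`, `t > 0` and `w ∈ V`,
`𝓕[(‖·‖² + t²)^{-s}](w) = π^{d/2} Γ(s)⁻¹ ∫₀^∞ μ^{s-1-d/2} exp(-π²‖w‖²/μ - μt²) dμ`,
with Mathlib's convention `𝓕 f (w) = ∫ exp(-2πi⟪v, w⟫) f(v) dv`. Equivalently (not proved here)
`= (2π^s/Γ(s)) (‖w‖/t)^{s-d/2} K_{s-d/2}(2πt‖w‖)`; Stein–Weiss, *Fourier Analysis on Euclidean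
Spaces*, Ch. I §1 and Ch. IV. [folklore] -/
theorem fourierIntegral_normSq_add_sq_rpow_neg
    {V : Type*} [NormedAddCommGroup V] [InnerProductSpace ℝ V] [FiniteDimensional ℝ V]
    [MeasurableSpace V] [BorelSpace V]
    {s t : ℝ} (hs : (Module.finrank ℝ V : ℝ) / 2 < s) (ht : 0 < t) (w : V) :
    𝓕 (fun v : V => (((‖v‖ ^ 2 + t ^ 2) ^ (-s) : ℝ) : ℂ)) w =
      ((Real.pi ^ ((Module.finrank ℝ V : ℝ) / 2) / Real.Gamma s *
        ∫ μ in Set.Ioi (0 : ℝ), μ ^ (s - 1 - (Module.finrank ℝ V : ℝ) / 2) *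
          Real.exp (-(Real.pi ^ 2 * ‖w‖ ^ 2 / μ) - μ * t ^ 2) : ℝ) : ℂ) := by
  have hd0 : (0 : ℝ) ≤ (Module.finrank ℝ V : ℝ) / 2 := by positivity
  have hs0 : 0 < s := hd0.trans_lt hs
  have hΓ : 0 < Real.Gamma s := Real.Gamma_pos_of_pos hs0
  -- the Schwinger weight and the two-variable integrand
  set c : ℝ → ℝ := fun μ => (Real.Gamma s)⁻¹ * (μ ^ (s - 1) * Real.exp (-(μ * t ^ 2))) with hc
  set F : V → ℝ → ℂ := fun v μ =>
    𝐞 (-⟪v, w⟫) • (((c μ : ℝ) : ℂ) * Complex.exp (-(μ : ℂ) * ‖v‖ ^ 2)) with hF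
  -- Step 1: Schwinger parametrisation of the Fourier integrand, pointwise in `v`.
  have step1 : ∀ v : V,
      𝐞 (-⟪v, w⟫) • ((((‖v‖ ^ 2 + t ^ 2) ^ (-s) : ℝ) : ℂ)) = ∫ μ in Ioi (0 : ℝ), F v μ := by
    intro v
    have hr : 0 < ‖v‖ ^ 2 + t ^ 2 := by positivity
    have hreal : ∀ μ : ℝ, ((c μ : ℝ) : ℂ) * Complex.exp (-(μ : ℂ) * ‖v‖ ^ 2) =
        (((Real.Gamma s)⁻¹ * (μ ^ (s - 1) * Real.exp (-((‖v‖ ^ 2 + t ^ 2) * μ))) : ℝ) : ℂ) := by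
      intro μ
      have e : -((‖v‖ ^ 2 + t ^ 2) * μ) = -(μ * t ^ 2) + -μ * ‖v‖ ^ 2 := by ring
      rw [e, Real.exp_add]
      simp only [hc]
      push_cast
      ring
    simp only [hF, Circle.smul_def, smul_eq_mul]
    rw [integral_const_mul]
    congr 1
    simp_rw [hreal]
    rw [integral_complex_ofReal, integral_const_mul, ← rpow_neg_eq_inv_Gamma_mul_integral hr hs0]
  -- Step 2: the two-variable integrand is integrable on `V × (0, ∞)`.
  have hint : Integrable (Function.uncurry F)
      ((volume : Measure V).prod ((volume : Measure ℝ).restrict (Ioi 0))) := by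
    have hmeas : AEStronglyMeasurable (Function.uncurry F)
        ((volume : Measure V).prod ((volume : Measure ℝ).restrict (Ioi 0))) :=
      (measurable_fourierChar_smul_schwinger_integrand s t w).aestronglyMeasurable
    rw [integrable_prod_iff' hmeas]
    refine ⟨?_, ?_⟩
    · filter_upwards [ae_restrict_mem measurableSet_Ioi] with μ hμ
      exact integrable_fourierChar_smul_const_mul_gaussian hμ (c μ) w
    · refine (integrableOn_schwinger_weight hs ht).congr_fun (fun μ hμ => ?_) measurableSet_Ioi
      exact (integral_norm_fourierChar_smul_const_mul_gaussian hμ (c μ) w).symm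
  -- Step 3: the inner `v`-integral for fixed `μ > 0` is a Gaussian Fourier transform.
  have step3 : ∀ μ ∈ Ioi (0 : ℝ), ∫ v : V, F v μ =
      ((c μ * ((π / μ) ^ ((Module.finrank ℝ V : ℝ) / 2) *
        Real.exp (-π ^ 2 * ‖w‖ ^ 2 / μ)) : ℝ) : ℂ) :=
    fun μ hμ => integral_fourierChar_smul_const_mul_gaussian hμ (c μ) w
  -- Step 4: assemble.
  calc 𝓕 (fun v : V => (((‖v‖ ^ 2 + t ^ 2) ^ (-s) : ℝ) : ℂ)) w
      = ∫ v : V, 𝐞 (-⟪v, w⟫) • ((((‖v‖ ^ 2 + t ^ 2) ^ (-s) : ℝ) : ℂ)) := Real.fourier_eq _ _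
    _ = ∫ v : V, ∫ μ in Ioi (0 : ℝ), F v μ := integral_congr_ae (Eventually.of_forall step1)
    _ = ∫ μ in Ioi (0 : ℝ), ∫ v : V, F v μ := integral_integral_swap hint
    _ = ∫ μ in Ioi (0 : ℝ), ((c μ * ((π / μ) ^ ((Module.finrank ℝ V : ℝ) / 2) *
          Real.exp (-π ^ 2 * ‖w‖ ^ 2 / μ)) : ℝ) : ℂ) :=
        setIntegral_congr_fun measurableSet_Ioi step3
    _ = _ := by
        rw [integral_complex_ofReal]
        congr 1
        rw [← integral_const_mul]
        refine setIntegral_congr_fun measurableSet_Ioi (fun μ hμ => ?_)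
        have hμ : (0 : ℝ) < μ := hμ
        simp only [hc]
        rw [Real.div_rpow Real.pi_pos.le hμ.le,
          Real.rpow_sub hμ (s - 1) ((Module.finrank ℝ V : ℝ) / 2),
          show -(π ^ 2 * ‖w‖ ^ 2 / μ) - μ * t ^ 2 = -(μ * t ^ 2) + -π ^ 2 * ‖w‖ ^ 2 / μ by ring,
          Real.exp_add]
        ring

end Literature.Analysis.Fourier
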